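import Literature.MathematicalPhysics.QuantumFieldTheory.Balaban1983to89.B9Thm311PosDefOpenZd

/-!
# `Balaban1983to89.B9Eq335UnitaryClassCompactZd` — [Balaban1985BackgroundPropagators] (3.35)–(3.36) p. 396 (the small-field class of UNITARY backgrounds) with
# Thm 3.11 p. 416 ∕ [Balaban1984PropagatorsII] p. 226 («the operator Δ_a is bounded from below by a positive constant»): THE UNITARY BACKGROUND CLASSES OF
# `ℤᵈ` ARE COMPACT (Tychonoff), and over a COMPACT class on which `Δ_a(U₀)` is positive definite with continuous letters there is ONE COERCIVITY CONSTANT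
# `c·⟨A, A⟩_τ ≤ ⟨A, Δ_a(U₀)A⟩_τ` — the engine of this seat's `B9Thm311CoerciveCompactZd` (Theorem 3.11 in quantitative currency per cube member)

statement-level skeleton of published theorems with citation tags; proofs where landed; nothing here is a claim about the
Yang–Mills mass gap

`[Balaban1985BackgroundPropagators]` ("B9", CMP **99** (1985) 389–434) p. 396 (3.35): the class of background configurations `U` (values in the compact
group `G`) with small plaquette variables; p. 416, Theorem 3.11: *«… the operators Δ′_a, G′, (Q′G′²Q′*)⁻¹, Δ_a, G are positive definite.»*
`[Balaban1984PropagatorsII]` ("[4]", CMP **96** (1984) 223–250) p. 226: *«the operator Δ_a is bounded from below by a positive constant, hence … G = Δ_a⁻¹»* —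
the QUANTITATIVE form of «positive definite» that every decay estimate downstream consumes (a Combes–Thomas step needs a number `c > 0`, not bare
positivity).  PDF held: `paper:balaban1985-cmp99-background-propagators` pp. 395–396, 416–418 (re-read by this seat, 2026-08-28).

CITATION HEADER (lean-in-tree rule).  Cell `pub-ymgap` (YM Track A, HUMAN RULING D-0062 ∕ D-0149 width push), DAG node N06 = [B9], width seat
`pub-ymgap-dag-n06-w4` (g4), CLAIM-1 ∕ INTENT-1 (split by the 400-line lint: this file = §1–§3, the cube theorems = `B9Thm311CoerciveCompactZd`).  Inputs BY
NAME: this seat's g3 `B9Thm311PosDefOpenZd` (`LettersContinuousWithinAt`, the openness engine whose compact twin §1 is), g2 `B9Eq327GreenZd` (`E(Ω₀)`,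
`⟨·,·⟩_τ`, `LinearOnDomAt`), dag-n06-b `B9Eq327GreenZdHerm` (`E_𝔤(Ω₀)`), `B7Prop2Explicit.unitaryUnits`; Mathlib `isClosed_unitary`, `Units.isOpenEmbedding_val`,
`isCompact_univ_pi`.

WHAT IS PROVED (kernel, 0 sorry; theorems only — no `def`, `instance`, `notation`).
* §1 (pure linear algebra ∕ topology, `[folklore]`) ★★ `exists_coercive_of_isCompact` — `K` compact; a family of bilinear forms `q x` on a finite-dimensional real
  space whose ENTRIES `x ↦ q x v w` are continuous on `K`; `q x` positive definite at every `x ∈ K`; `N` ANY bilinear form ⟹ ONE constant `c > 0` with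
  `c·N v v ≤ q x v v` for all `x ∈ K` and all `v` (joint continuity on `K ×` the coordinate sphere; minimum of a positive continuous function on a compact set).
* §2 (topology of the background classes, finite-dimensional nontrivial C⋆-fibre) `isCompact_unitary` (the unitaries form a compact set), ★ `isCompact_unitaryUnits`
  (the same inside the unit group with its own topology), ★★ `isCompact_setOf_forall_mem_unitaryUnits` (THE UNITARY CONFIGURATIONS OF `ℤᵈ` FORM A COMPACT SET
  in the product topology — Tychonoff), `continuous_bondVal`, `isClosed_setOf_forall_norm_sub_one_le`, ★ `isCompact_unitary_closedBall` (unitary AND uniformly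
  `δ`-close to `1`: compact).
* §3 (carrier, ANY record `o`, finite `Ω₀`) `continuousWithinAt_bondPair_deltaAOf₂` (the ENTRIES `U₀ ↦ ⟨A, Δ_a(U₀)B⟩_τ` are continuous where the letters are),
  ★★ `exists_coercive_on_of_isCompact` — `K ⊆ 𝒰` compact, `Δ_a(U₀)` ℝ-linear on `E(Ω₀)` for `U₀ ∈ 𝒰`, letters continuous within `𝒰` at every point of `K` on
  `E_𝔤(Ω₀)`, `Δ_a(U₀)` positive definite on `E_𝔤(Ω₀)` at every `U₀ ∈ K` ⟹ ∃ `c > 0`, `c·⟨A, A⟩_τ ≤ ⟨A, Δ_a(U₀)A⟩_τ` for ALL `U₀ ∈ K`, all Hermitian `A ∈ E(Ω₀)`.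

HONEST SCOPE.  Pure topology ∕ linear algebra + one carrier reading; the constant `c` is NON-QUANTITATIVE (compactness × finite dimension); nothing of
Theorem 3.3 ∕ (3.115); `τ` is a PARAMETER (no instance); A6: §3 is inhabited at every cube member by the companion file (`K` = the uniform closed ball around
`1`).  Count-neutral helper (`--supports stmt-QuantumFields-20542`); N05 ∕ N06 NOT discharged; K1⁷ NOT closed; one finite `𝕋⁴` programme at fixed `ε`, Bałaban
as printed; R4 closes only the conditional finite-`𝕋⁴` rung `BalabanLadder.UV` — nothing continuum ∕ ℝ⁴ ∕ OS ∕ mass gap ∕ Clay.  Unit `pub-ymgap-dag-n06-w4`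
(g4), 2026-08-28.
-/

noncomputable section

namespace Literature.MathematicalPhysics.QuantumFieldTheory.Balaban1983to89.B9Eq335UnitaryClassCompactZd

open Filter Topology
open B7Prop1Explicit
open B7Prop2Explicit (unitaryUnits)
open B8Ineq132 (BondTouches)
open B9SupplySockB9P3ZdLetters (OpsZd deltaAOf)
open B9Eq316AveragingTransposeZd (tauForm)
open B9Eq327GreenZd (domSub bondPair LinearOnDomAt setOf_bondTouches_finite finiteDimensional_domSub)
open B9Eq327GreenZdHerm (domSubH domSubH_le)
open B9Thm311PosDefOpenZd (LettersContinuousWithinAt eq_zero_of_not_mem_bondFinset continuous_tauForm_right)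
open B9Thm311FlatHermKernelZd (bondPair_eq_sum_of_vanish_off)

-- `Site` alone could resolve to the torus sites of `Setup.lean`; re-export the `ℤ^d` sites of `B7Prop1Explicit`.
export B7Prop1Explicit (Site)

/-! ## §1  Linear algebra: a continuously-parametrised positive definite form on a finite-dimensional space is UNIFORMLY coercive on a compact parameter set -/

section Abstract

variable {X : Type*} [TopologicalSpace X] {V : Type*} [AddCommGroup V] [Module ℝ V] [FiniteDimensional ℝ V]

omit [FiniteDimensional ℝ V] in
/-- coordinates: a bilinear form on the vectors with coordinates `c`, `c'` in a basis `b` is the double sum of its entries. [folklore] -/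
private theorem bilin_equivFun_symm_eq_sum {n : ℕ} (b : Module.Basis (Fin n) ℝ V) (B : V →ₗ[ℝ] V →ₗ[ℝ] ℝ) (c c' : Fin n → ℝ) :
    B (b.equivFun.symm c) (b.equivFun.symm c') = ∑ i, ∑ j, c i * c' j * B (b i) (b j) := by
  simp only [Module.Basis.equivFun_symm_apply, map_sum, map_smul, LinearMap.sum_apply, LinearMap.smul_apply, smul_eq_mul,
    Finset.mul_sum]
  rw [Finset.sum_comm]
  refine Finset.sum_congr rfl fun i _ => Finset.sum_congr rfl fun j _ => ?_
  ring

/-- ★★ **UNIFORM COERCIVITY ON A COMPACT PARAMETER SET** for a family of bilinear forms on a finite-dimensional real space whose ENTRIES are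
continuous on `K`: if `q x` is positive definite at every `x ∈ K` (`K` compact), then for ANY bilinear form `N` there is ONE constant `c > 0` with
`c·N v v ≤ q x v v` for all `x ∈ K` and all `v`.  (In coordinates the function `(x, c) ↦ q x c c` is jointly continuous and positive on the compact set
`K × {‖c‖ = 1}`, hence `≥ m > 0` there; `N c c ≤ M` on the sphere; take `c = m ∕ (M + 1)`.)  The linear-algebra mechanism behind [4] p. 226 «bounded
from below by a positive constant» read uniformly over a compact class of backgrounds.
[cite: Balaban1985BackgroundPropagators, Thm 3.11 p.416; Balaban1984PropagatorsII, p.226 (bookkeeping: the finite-dimensional compactness mechanism, not a printed statement)] -/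
theorem exists_coercive_of_isCompact (q : X → V →ₗ[ℝ] V →ₗ[ℝ] ℝ) (N : V →ₗ[ℝ] V →ₗ[ℝ] ℝ) {K : Set X} (hK : IsCompact K)
    (hcont : ∀ v w : V, ContinuousOn (fun x => q x v w) K) (hpos : ∀ x ∈ K, ∀ v : V, v ≠ 0 → 0 < q x v v) :
    ∃ c : ℝ, 0 < c ∧ ∀ x ∈ K, ∀ v : V, c * N v v ≤ q x v v := by
  classical
  set n : ℕ := Module.finrank ℝ V with hn
  let b : Module.Basis (Fin n) ℝ V := Module.finBasis ℝ V
  -- the unit sphere of the coordinate space (sup norm) is compact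
  set S : Set (Fin n → ℝ) := Metric.sphere (0 : Fin n → ℝ) 1 with hS
  have hSc : IsCompact S := isCompact_sphere (0 : Fin n → ℝ) 1
  have hKS : IsCompact (K ×ˢ S) := hK.prod hSc
  -- `q` in coordinates is jointly continuous on `K × S`
  let F : X × (Fin n → ℝ) → ℝ := fun p => ∑ i, ∑ j, p.2 i * p.2 j * q p.1 (b i) (b j)
  have hF : ContinuousOn F (K ×ˢ S) := by
    refine continuousOn_finsetSum _ fun i _ => continuousOn_finsetSum _ fun j _ => ?_
    have h1 : ContinuousOn (fun p : X × (Fin n → ℝ) => p.2 i * p.2 j) (K ×ˢ S) :=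
      (((continuous_apply i).comp continuous_snd).mul ((continuous_apply j).comp continuous_snd)).continuousOn
    have h2 : ContinuousOn (fun p : X × (Fin n → ℝ) => q p.1 (b i) (b j)) (K ×ˢ S) :=
      (hcont (b i) (b j)).comp continuous_fst.continuousOn fun p hp => (Set.mem_prod.1 hp).1
    exact h1.mul h2
  -- and positive there
  have hF' : ∀ p ∈ K ×ˢ S, (0 : ℝ) < F p := by
    rintro ⟨x, c⟩ hp
    obtain ⟨hx, hc⟩ := Set.mem_prod.1 hp
    show 0 < ∑ i, ∑ j, c i * c j * q x (b i) (b j)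
    rw [← bilin_equivFun_symm_eq_sum b (q x) c c]
    refine hpos x hx _ fun h0 => ?_
    have hc0 : c = 0 := by
      have := congrArg b.equivFun h0
      rwa [LinearEquiv.apply_symm_apply, map_zero] at this
    rw [hS, mem_sphere_zero_iff_norm, hc0, norm_zero] at hc
    exact zero_ne_one hc
  obtain ⟨m, hm0, hm⟩ := hKS.exists_forall_le' hF hF'
  -- `N` in coordinates is bounded on the sphere by the sum of the absolute values of its entries
  set M : ℝ := ∑ i : Fin n, ∑ j : Fin n, |N (b i) (b j)| with hM
  have hM0 : 0 ≤ M := Finset.sum_nonneg fun i _ => Finset.sum_nonneg fun j _ => abs_nonneg _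
  have hNle : ∀ c ∈ S, ∑ i, ∑ j, c i * c j * N (b i) (b j) ≤ M := by
    intro c hc
    have hcoord : ∀ i, |c i| ≤ 1 := by
      intro i
      have h1 : ‖c i‖ ≤ ‖c‖ := norm_le_pi_norm c i
      rw [mem_sphere_zero_iff_norm.1 hc] at h1
      exact h1
    refine Finset.sum_le_sum fun i _ => Finset.sum_le_sum fun j _ => ?_
    have hprod : |c i * c j| ≤ 1 := by
      rw [abs_mul]
      exact mul_le_one₀ (hcoord i) (abs_nonneg _) (hcoord j)
    calc c i * c j * N (b i) (b j) ≤ |c i * c j * N (b i) (b j)| := le_abs_self _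
      _ = |c i * c j| * |N (b i) (b j)| := abs_mul _ _
      _ ≤ 1 * |N (b i) (b j)| := mul_le_mul_of_nonneg_right hprod (abs_nonneg _)
      _ = |N (b i) (b j)| := one_mul _
  -- the constant
  refine ⟨m / (M + 1), div_pos hm0 (by linarith), fun x hx v => ?_⟩
  by_cases hv : v = 0
  · subst hv
    simp only [map_zero, mul_zero, le_refl]
  -- coordinates of `v`, normalised to the sphere
  set cv : Fin n → ℝ := b.equivFun v with hcvdef
  have hvc : v = b.equivFun.symm cv := by rw [hcvdef, LinearEquiv.symm_apply_apply]
  have hcv0 : cv ≠ 0 := by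
    intro h0
    exact hv (by rw [hvc, h0, map_zero])
  set r : ℝ := ‖cv‖ with hr
  have hrpos : 0 < r := norm_pos_iff.2 hcv0
  set c' : Fin n → ℝ := r⁻¹ • cv with hc'
  have hc'S : c' ∈ S := by
    rw [hS, mem_sphere_zero_iff_norm, hc', norm_smul, norm_inv, Real.norm_of_nonneg hrpos.le, inv_mul_cancel₀ hrpos.ne']
  have hcc' : cv = r • c' := by rw [hc', smul_smul, mul_inv_cancel₀ hrpos.ne', one_smul]
  -- `B v v = r² · B_coord(c')` for both forms
  have hscale : ∀ B : V →ₗ[ℝ] V →ₗ[ℝ] ℝ, B v v = r ^ 2 * ∑ i, ∑ j, c' i * c' j * B (b i) (b j) := by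
    intro B
    rw [hvc, bilin_equivFun_symm_eq_sum b B cv cv, hcc', Finset.mul_sum]
    refine Finset.sum_congr rfl fun i _ => ?_
    rw [Finset.mul_sum]
    refine Finset.sum_congr rfl fun j _ => ?_
    simp only [Pi.smul_apply, smul_eq_mul]
    ring
  have hqv : r ^ 2 * m ≤ q x v v := by
    rw [hscale (q x)]
    exact mul_le_mul_of_nonneg_left (hm ⟨x, c'⟩ (Set.mk_mem_prod hx hc'S)) (by positivity)
  have hNv : N v v ≤ r ^ 2 * M := by
    rw [hscale N]
    exact mul_le_mul_of_nonneg_left (hNle c' hc'S) (by positivity)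
  have hr2 : 0 ≤ r ^ 2 := by positivity
  have hM1 : 0 < M + 1 := by linarith
  -- `(m ∕ (M+1))·N v v ≤ (m ∕ (M+1))·r²M ≤ r²m ≤ q x v v`
  have h1 : m / (M + 1) * N v v ≤ m / (M + 1) * (r ^ 2 * M) :=
    mul_le_mul_of_nonneg_left hNv (div_pos hm0 hM1).le
  have h2 : m / (M + 1) * (r ^ 2 * M) ≤ r ^ 2 * m := by
    rw [div_mul_eq_mul_div, div_le_iff₀ hM1]
    nlinarith [mul_nonneg hr2 hm0.le, hM0]
  linarith

end Abstract

/-! ## §2  Topology: the unitary background classes of `ℤᵈ` are compact (Tychonoff), the uniform balls around `1` closed -/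

section Compact

variable {d : ℕ} {𝔸 : Type*} [CStarAlgebra 𝔸] [FiniteDimensional ℝ 𝔸] [Nontrivial 𝔸]

/-- **the unitaries of a finite-dimensional C⋆-algebra form a COMPACT subset** (closed — Mathlib `isClosed_unitary` — and bounded by `1`, in a proper space).
[cite: Balaban1985BackgroundPropagators, p.396 (3.35) («U(b) ∈ G», G compact) (bookkeeping)] -/
theorem isCompact_unitary : IsCompact (unitary 𝔸 : Set 𝔸) := by
  refine Metric.isCompact_of_isClosed_isBounded isClosed_unitary ?_
  refine (Metric.isBounded_closedBall (x := (0 : 𝔸)) (r := 1)).subset fun a ha => ?_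
  rw [Metric.mem_closedBall, dist_zero_right]
  exact (CStarRing.norm_of_mem_unitary ha).le

/-- ★ **THE UNITARY UNITS FORM A COMPACT SUBSET OF THE UNIT GROUP** (with its own topology): the value map `𝔸ˣ → 𝔸` is an embedding (Mathlib
`Units.isOpenEmbedding_val`) whose image of `unitaryUnits 𝔸` is exactly `unitary 𝔸`. [cite: Balaban1985BackgroundPropagators, p.396 (3.35) (bookkeeping)] -/
theorem isCompact_unitaryUnits : IsCompact (unitaryUnits 𝔸 : Set 𝔸ˣ) := by
  rw [(Units.isOpenEmbedding_val (R := 𝔸)).isEmbedding.isCompact_iff]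
  have himg : (Units.val : 𝔸ˣ → 𝔸) '' (unitaryUnits 𝔸 : Set 𝔸ˣ) = (unitary 𝔸 : Set 𝔸) := by
    ext a
    constructor
    · rintro ⟨u, hu, rfl⟩
      exact hu
    · intro ha
      refine ⟨⟨a, star a, Unitary.mul_star_self_of_mem ha, Unitary.star_mul_self_of_mem ha⟩, ?_, rfl⟩
      show ((⟨a, star a, _, _⟩ : 𝔸ˣ) : 𝔸) ∈ unitary 𝔸
      exact ha
  rw [himg]
  exact isCompact_unitary

/-- ★★ **THE UNITARY CONFIGURATIONS OF `ℤᵈ` FORM A COMPACT SET** in the product topology on `ℤᵈ × {directions} → 𝔸ˣ` (Tychonoff: a product of copies of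
the compact unitary group). [cite: Balaban1985BackgroundPropagators, p.396 (3.35) («the space of configurations U» with values in the compact G) (bookkeeping)] -/
theorem isCompact_setOf_forall_mem_unitaryUnits :
    IsCompact {U : Site d → Fin d → 𝔸ˣ | ∀ x κ, U x κ ∈ unitaryUnits 𝔸} := by
  have hset : {U : Site d → Fin d → 𝔸ˣ | ∀ x κ, U x κ ∈ unitaryUnits 𝔸} =
      Set.pi Set.univ (fun _ : Site d => Set.pi Set.univ (fun _ : Fin d => (unitaryUnits 𝔸 : Set 𝔸ˣ))) := by
    ext U
    simp only [Set.mem_setOf_eq, Set.mem_univ_pi, SetLike.mem_coe]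
  rw [hset]
  exact isCompact_univ_pi fun _ => isCompact_univ_pi fun _ => isCompact_unitaryUnits

omit [FiniteDimensional ℝ 𝔸] [Nontrivial 𝔸] in
/-- the bond variable `U ↦ U(x, κ) ∈ 𝔸` is continuous in the product topology. [cite: Balaban1985RegularSpaces, (1.1) p.76 (bookkeeping)] -/
theorem continuous_bondVal (x : Site d) (κ : Fin d) : Continuous fun U : Site d → Fin d → 𝔸ˣ => ((U x κ : 𝔸ˣ) : 𝔸) :=
  Units.continuous_val.comp ((continuous_apply κ).comp (continuous_apply x))

omit [FiniteDimensional ℝ 𝔸] [Nontrivial 𝔸] in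
/-- **the uniform closed ball «`‖U(b) − 1‖ ≤ δ` for every bond» is CLOSED** in the product topology (an intersection of closed conditions on single
bond variables). [cite: Balaban1985BackgroundPropagators, (3.36) p.396 («|A| small» in the small-field gauge) (bookkeeping)] -/
theorem isClosed_setOf_forall_norm_sub_one_le (δ : ℝ) :
    IsClosed {U : Site d → Fin d → 𝔸ˣ | ∀ x κ, ‖((U x κ : 𝔸ˣ) : 𝔸) - 1‖ ≤ δ} := by
  have hset : {U : Site d → Fin d → 𝔸ˣ | ∀ x κ, ‖((U x κ : 𝔸ˣ) : 𝔸) - 1‖ ≤ δ} =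
      ⋂ x : Site d, ⋂ κ : Fin d, {U : Site d → Fin d → 𝔸ˣ | ‖((U x κ : 𝔸ˣ) : 𝔸) - 1‖ ≤ δ} := by
    ext U
    simp only [Set.mem_setOf_eq, Set.mem_iInter]
  rw [hset]
  refine isClosed_iInter fun x => isClosed_iInter fun κ => ?_
  exact isClosed_le ((continuous_bondVal x κ).sub continuous_const).norm continuous_const

/-- ★ **«UNITARY AND UNIFORMLY `δ`-CLOSE TO `1`» IS A COMPACT CLASS OF BACKGROUNDS** (compact ∩ closed).
[cite: Balaban1985BackgroundPropagators, (3.35)–(3.36) p.396 (bookkeeping)] -/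
theorem isCompact_unitary_closedBall (δ : ℝ) :
    IsCompact {U : Site d → Fin d → 𝔸ˣ | (∀ x κ, U x κ ∈ unitaryUnits 𝔸) ∧ ∀ x κ, ‖((U x κ : 𝔸ˣ) : 𝔸) - 1‖ ≤ δ} := by
  have hset : {U : Site d → Fin d → 𝔸ˣ | (∀ x κ, U x κ ∈ unitaryUnits 𝔸) ∧ ∀ x κ, ‖((U x κ : 𝔸ˣ) : 𝔸) - 1‖ ≤ δ} =
      {U : Site d → Fin d → 𝔸ˣ | ∀ x κ, U x κ ∈ unitaryUnits 𝔸} ∩ {U : Site d → Fin d → 𝔸ˣ | ∀ x κ, ‖((U x κ : 𝔸ˣ) : 𝔸) - 1‖ ≤ δ} := by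
    ext U; simp only [Set.mem_setOf_eq, Set.mem_inter_iff]
  rw [hset]
  exact isCompact_setOf_forall_mem_unitaryUnits.inter_right (isClosed_setOf_forall_norm_sub_one_le δ)

end Compact

/-! ## §3  The carrier: ONE coercivity constant for `Δ_a(U₀)` on `E_𝔤(Ω₀)` over a compact class of backgrounds -/

section Carrier

variable {d : ℕ} {𝔸 : Type*} [CStarAlgebra 𝔸] [FiniteDimensional ℝ 𝔸] (τ : 𝔸 →ₗ[ℂ] ℂ)

/-- the ENTRY `U₀ ↦ ⟨A, Δ_a(U₀)B⟩_τ` is continuous within `S` at a point where the letters are, for `A ∈ E(Ω₀)` (finite `Ω₀`) and `B` in the class `W` on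
which the letters are continuous (a finite sum of continuous fibre pairings; the two-field twin of `B9Thm311ContinuityMethodZd.continuousWithinAt_bondPair_deltaAOf`).
[cite: Balaban1985BackgroundPropagators, (3.26) p.395 (bookkeeping)] -/
theorem continuousWithinAt_bondPair_deltaAOf₂ {η : ℝ} {o : OpsZd d 𝔸} {Ω₀ : Set (Site d)} (hΩ : Ω₀.Finite)
    {W : Submodule ℝ (Site d → Fin d → 𝔸)} {S : Set (Site d → Fin d → 𝔸ˣ)} {U₁ : Site d → Fin d → 𝔸ˣ}
    (hcont : LettersContinuousWithinAt η o Ω₀ W S U₁) {A B : Site d → Fin d → 𝔸} (hA : A ∈ domSub (𝔸 := 𝔸) Ω₀) (hB : B ∈ W) :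
    ContinuousWithinAt (fun U₀ => bondPair τ A (deltaAOf η o U₀ B)) S U₁ := by
  classical
  let T : Finset (Site d × Fin d) := (setOf_bondTouches_finite (d := d) hΩ).toFinset
  have hvan : ∀ b : Site d × Fin d, b ∉ T → A b.1 b.2 = 0 := fun b hb => eq_zero_of_not_mem_bondFinset hΩ hA b hb
  have heq : (fun U₀ => bondPair τ A (deltaAOf η o U₀ B)) = fun U₀ => ∑ b ∈ T, tauForm τ (A b.1 b.2) (deltaAOf η o U₀ B b.1 b.2) := by
    funext U₀
    exact bondPair_eq_sum_of_vanish_off τ T hvan _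
  rw [heq]
  refine tendsto_finsetSum _ fun b hb => ?_
  have hbT : BondTouches Ω₀ b.1 b.2 := (setOf_bondTouches_finite (d := d) hΩ).mem_toFinset.1 hb
  exact ((continuous_tauForm_right τ (A b.1 b.2)).tendsto _).comp (hcont B hB b.1 b.2 hbT)

/-- ★★ **[4] p. 226 ∕ THEOREM 3.11 IN QUANTITATIVE CURRENCY OVER A COMPACT CLASS OF BACKGROUNDS** (finite `Ω₀`, finite-dimensional fibre, faithful `τ`).
Let `K ⊆ 𝒰` be a COMPACT set of backgrounds (product topology); suppose `Δ_a(U₀)` is ℝ-linear on `E(Ω₀)` for `U₀ ∈ 𝒰`, its letters are continuous within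
`𝒰` at every point of `K` on `E_𝔤(Ω₀)`, and `Δ_a(U₀)` is positive definite on `E_𝔤(Ω₀)` at every `U₀ ∈ K`.  Then there is ONE constant `c > 0` with
`c·⟨A, A⟩_τ ≤ ⟨A, Δ_a(U₀)A⟩_τ` for ALL `U₀ ∈ K` and all Hermitian `A ∈ E(Ω₀)` — «bounded from below by a positive constant», the constant uniform over `K`.
(§1 applied to the bilinear forms `(A, B) ↦ Σ_b Re τ(A(b)* (Δ_a(U₀)B)(b))` on `E_𝔤(Ω₀)` and `N = ⟨·, ·⟩_τ`.)
[cite: Balaban1985BackgroundPropagators, Thm 3.11 p.416, (3.26)–(3.27) p.395; Balaban1984PropagatorsII, p.226] -/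
theorem exists_coercive_on_of_isCompact {η : ℝ} {o : OpsZd d 𝔸} {Ω₀ : Set (Site d)}
    (hΩ : Ω₀.Finite) {𝒰 K : Set (Site d → Fin d → 𝔸ˣ)} (hK𝒰 : K ⊆ 𝒰) (hK : IsCompact K)
    (hlin : ∀ U₀ ∈ 𝒰, LinearOnDomAt η o Ω₀ U₀) (hcont : ∀ U₁ ∈ K, LettersContinuousWithinAt η o Ω₀ (domSubH Ω₀) 𝒰 U₁)
    (hpos : ∀ U₀ ∈ K, ∀ A ∈ domSubH (𝔸 := 𝔸) Ω₀, A ≠ 0 → 0 < bondPair τ A (deltaAOf η o U₀ A)) :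
    ∃ c : ℝ, 0 < c ∧ ∀ U₀ ∈ K, ∀ A ∈ domSubH (𝔸 := 𝔸) Ω₀, c * bondPair τ A A ≤ bondPair τ A (deltaAOf η o U₀ A) := by
  classical
  haveI : FiniteDimensional ℝ (domSub (𝔸 := 𝔸) Ω₀) := finiteDimensional_domSub hΩ
  let W : Submodule ℝ (Site d → Fin d → 𝔸) := domSubH Ω₀
  have hW : W ≤ domSub (𝔸 := 𝔸) Ω₀ := domSubH_le Ω₀
  haveI : FiniteDimensional ℝ W := Submodule.finiteDimensional_of_le hW
  choose! T hT using hlin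
  let S : Finset (Site d × Fin d) := (setOf_bondTouches_finite (d := d) hΩ).toFinset
  have hS : ∀ A ∈ W, ∀ b : Site d × Fin d, b ∉ S → A b.1 b.2 = 0 :=
    fun A hA b hb => eq_zero_of_not_mem_bondFinset hΩ (hW hA) b hb
  -- evaluation at a bond, as a linear map
  let ev : Site d × Fin d → ((Site d → Fin d → 𝔸) →ₗ[ℝ] 𝔸) := fun b =>
    (LinearMap.proj (R := ℝ) (φ := fun _ : Fin d => 𝔸) b.2).comp (LinearMap.proj (R := ℝ) (φ := fun _ : Site d => Fin d → 𝔸) b.1)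
  -- the bilinear forms `q U (A, B) = Σ_{b ∈ S} Re τ(A(b)* (T U B)(b))` and `N (A, B) = Σ_{b ∈ S} Re τ(A(b)* B(b))` on `W`
  let q : (Site d → Fin d → 𝔸ˣ) → W →ₗ[ℝ] W →ₗ[ℝ] ℝ := fun U =>
    ∑ b ∈ S, (tauForm τ).compl₁₂ ((ev b).comp W.subtype) ((ev b).comp ((T U).comp W.subtype))
  let N : W →ₗ[ℝ] W →ₗ[ℝ] ℝ := ∑ b ∈ S, (tauForm τ).compl₁₂ ((ev b).comp W.subtype) ((ev b).comp W.subtype)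
  have hq : ∀ U (A B : W), q U A B = ∑ b ∈ S, tauForm τ ((A : Site d → Fin d → 𝔸) b.1 b.2) (T U B b.1 b.2) := by
    intro U A B
    simp only [q, LinearMap.sum_apply, LinearMap.compl₁₂_apply, LinearMap.comp_apply, Submodule.subtype_apply, ev,
      LinearMap.proj_apply]
  have hN : ∀ A B : W, N A B = ∑ b ∈ S, tauForm τ ((A : Site d → Fin d → 𝔸) b.1 b.2) ((B : Site d → Fin d → 𝔸) b.1 b.2) := by
    intro A B
    simp only [N, LinearMap.sum_apply, LinearMap.compl₁₂_apply, LinearMap.comp_apply, Submodule.subtype_apply, ev,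
      LinearMap.proj_apply]
  -- on `𝒰` the entries are the pairings
  have hqU : ∀ U ∈ 𝒰, ∀ A B : W, q U A B = bondPair τ (A : Site d → Fin d → 𝔸) (deltaAOf η o U B) := by
    intro U hU A B
    rw [hq, bondPair_eq_sum_of_vanish_off τ S (hS A A.2)]
    refine Finset.sum_congr rfl fun b _ => ?_
    rw [hT U hU B (hW B.2)]
  have hNA : ∀ A : W, N A A = bondPair τ (A : Site d → Fin d → 𝔸) A := by
    intro A
    rw [hN, bondPair_eq_sum_of_vanish_off τ S (hS A A.2)]
  -- the entries are continuous on `K`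
  have hcq : ∀ A B : W, ContinuousOn (fun U => q U A B) K := by
    intro A B U₁ hU₁
    have h : ContinuousWithinAt (fun U => bondPair τ (A : Site d → Fin d → 𝔸) (deltaAOf η o U B)) 𝒰 U₁ :=
      continuousWithinAt_bondPair_deltaAOf₂ τ hΩ (hcont U₁ hU₁) (hW A.2) B.2
    refine (h.mono hK𝒰).congr (fun U hU => hqU U (hK𝒰 hU) A B) (hqU U₁ (hK𝒰 hU₁) A B)
  -- positivity on `K`
  have hposq : ∀ U ∈ K, ∀ A : W, A ≠ 0 → 0 < q U A A := by
    intro U hU A hA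
    rw [hqU U (hK𝒰 hU) A A]
    exact hpos U hU A A.2 fun h => hA (Subtype.ext h)
  obtain ⟨c, hc, hcoer⟩ := exists_coercive_of_isCompact q N hK hcq hposq
  refine ⟨c, hc, fun U hU A hA => ?_⟩
  have h := hcoer U hU ⟨A, hA⟩
  rwa [hqU U (hK𝒰 hU), hNA] at h

end Carrier

end Literature.MathematicalPhysics.QuantumFieldTheory.Balaban1983to89.B9Eq335UnitaryClassCompactZd

end
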